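/-
Copyright: derived here (Resolution Observatory cell `pub-rosobs`, carver gen 56). AI-written Lean; AI review is weaker than expert
review.  Companion file of the cell's POLYNOMIAL weighted-centre model `W(f)`: engine 1's LEMMA CP / CP′ ("pure vectors of composites
and inverses", THEOREM-FC-eng1-g37 §2; CARVER-NOTES-eng1-g37 T46) at the level of ring endomorphisms of `k[ε][σ]`, and the even-class
cancellation of LEMMA FC case (A) (THEOREM-FC-eng1-g37 §4 (A); T49).
Instrument — NOT a resolution theorem and NOT a statement about the invariant of [AbramovichTemkinWlodarczyk2024].
-/
import Literature.AlgebraicGeometry.Resolution.WeightedCentreIsotropyTwist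
import Literature.AlgebraicGeometry.Resolution.WeightedCentreEvenReparam
import Mathlib.Algebra.MvPolynomial.Variables
import Mathlib.Algebra.MvPolynomial.CommRing
import HarnessLib

/-!
# Pure vectors of composites, inverses and `σ ↦ −σ` twists

Setting (as in `WeightedCentreIsotropyTwist` / `WeightedCentreGradedIsotropy`): `A₀ = k[ε_ι] = MvPolynomial ι k`, the parameter ring
`A₀[σ] = A₀[X]`, and ring endomorphisms `Φ` of `A₀[X]` fixing the scalars `C (C c)` and `X = σ` (the cell's substitutions
`ε_i ↦ ε_i + A_i(σ, ε)`).  "Setting `ε = 0`" is the ring map `pureMap : A₀[X] → k[X]` (coefficientwise `constantCoeff`), and the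
**pure vector** of `Φ` is `pureVec Φ i := pureMap (Φ ε_i) ∈ k[σ]` — its `σ^s`-coefficient is `GradedIsotropy.pureCoeff Φ i s`
(`coeff_pureVec`; that file is not imported here, the identification is by unfolding).

* `pureMap_map` : `pureMap (Φ f) = f(ε ↦ pureVec Φ, σ ↦ σ)` — after setting `ε = 0`, `Φ` is evaluation at its own pure vector;
* `pureMap_map_eq_pureMap_of_vars` : if every `ε`-variable occurring in `B` is a slot `j` with `pureVec Φ j = 0`, then
  `pureMap (Φ B) = pureMap B`;
* **LEMMA CP** (`pureVec_comp`): if every `ε`-variable of the impure part `Ψ ε_i − ε_i` is a slot on which `Φ` has no pure term,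
  then `pureVec (Φ ∘ Ψ) i = pureVec Φ i + pureVec Ψ i` (in the cell the hypothesis is what GRADEDNESS gives on the slots of weight
  `≤ w̄ = min (w*(Φ), w*(Ψ))`: the impure variables of slot `i` are lighter than `w_i ≤ w*(Φ)`);
* **LEMMA CP′** (`pureVec_eq_neg_of_comp_apply`): if moreover `Φ (Ψ ε_i) = ε_i` then `pureVec Ψ i = − pureVec Φ i`;
* `pureVec_twistConj` : `pureVec Φ_{−σ} i = τ (pureVec Φ i)`, coefficientwise `(−1)^n` (`coeff_pureVec_twistConj`);
* **FC (A), even-class cancellation** (`pureVec_comp_of_twistConj_apply`, `coeff_pureVec_comp_of_twistConj_apply`):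
  for `Θ₂ = Φ_σ ∘ Ψ` with `Ψ` a right inverse of `Φ_{−σ}` on slot `i` and the same variable hypothesis,
  `pureVec Θ₂ i = pureVec Φ i − τ (pureVec Φ i)`, whose `σ^n`-coefficient is `(1 − (−1)^n)·c_n` — ZERO for even `n`
  (`coeff_pureVec_comp_of_twistConj_apply_eq_zero`): the class-`w*` pure parts cancel when `j*` is even;
* bookkeeping for the end of (A): `eq_twistConj_of_comp` (`Φ ∘ Ψ = id` with `Ψ` a two-sided inverse of `Φ_{−σ}` ⇒ `Φ = Φ_{−σ}`) and
  `isSigmaEven_map_C_of_twistConj_eq` (`Φ_{−σ} = Φ`, `2` regular ⇒ every `Φ (C a)` is even in `σ`, hence `= g(σ²)` by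
  `IsSigmaEven.expand_contract` of `WeightedCentreEvenReparam` — the `v := σ²` re-parametrisation; T49 (ii), "coefficients off `mℕ`
  vanish ⇒ polynomial in `σ^m`", is `expand_contract_of_coeff` there).

What is NOT here (engine 1's modelling): weights / `w*` / gradedness (the variable hypothesis is taken as a hypothesis), the
existence of the inverse `Ψ`, the free hypotheses (H1), (Hmax), (H>) and the conclusion of FC (A).

Pattern cite [cite: SerreLocalFields1979, Ch. II §4 Lemma 1] (bookkeeping of substitutions `≡ id` modulo an ideal, as in the
companion files); formalisation and statements ours, elementary.
-/

namespace Literature.AlgebraicGeometry.Resolution.WeightedBlowup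

open Polynomial

section PureVector

variable {k : Type*} [CommRing k] {ι : Type*}

/-! ## Setting `ε = 0` and the pure vector -/

/-- "Set `ε = 0`": the ring map `k[ε][σ] → k[σ]` applying `constantCoeff` coefficientwise (ours).
[cite: SerreLocalFields1979, Ch. II §4 Lemma 1] -/
noncomputable def pureMap : (MvPolynomial ι k)[X] →+* k[X] := mapRingHom MvPolynomial.constantCoeff

/-- Unfolding (plumbing). [cite: SerreLocalFields1979, Ch. II §4 Lemma 1] -/
theorem pureMap_apply (f : (MvPolynomial ι k)[X]) : pureMap f = f.map MvPolynomial.constantCoeff := rfl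

/-- `pureMap σ = σ` (plumbing). [cite: SerreLocalFields1979, Ch. II §4 Lemma 1] -/
@[simp] theorem pureMap_X : pureMap (X : (MvPolynomial ι k)[X]) = X := map_X _

/-- `pureMap (C a) = C (a(0))` (plumbing). [cite: SerreLocalFields1979, Ch. II §4 Lemma 1] -/
@[simp] theorem pureMap_C (a : MvPolynomial ι k) : pureMap (C a : (MvPolynomial ι k)[X]) = C (MvPolynomial.constantCoeff a) :=
  map_C _

/-- `pureMap ε_i = 0` (plumbing). [cite: SerreLocalFields1979, Ch. II §4 Lemma 1] -/
theorem pureMap_C_X (i : ι) : pureMap (C (MvPolynomial.X i) : (MvPolynomial ι k)[X]) = 0 := by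
  rw [pureMap_C, MvPolynomial.constantCoeff_X, map_zero]

/-- `pureMap` fixes the scalars (plumbing). [cite: SerreLocalFields1979, Ch. II §4 Lemma 1] -/
theorem pureMap_C_C (c : k) : pureMap (C (MvPolynomial.C c) : (MvPolynomial ι k)[X]) = C c := by
  rw [pureMap_C, MvPolynomial.constantCoeff_C]

/-- Coefficients of `pureMap f` (plumbing). [cite: SerreLocalFields1979, Ch. II §4 Lemma 1] -/
theorem coeff_pureMap (f : (MvPolynomial ι k)[X]) (n : ℕ) :
    (pureMap f).coeff n = MvPolynomial.constantCoeff (f.coeff n) :=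
  coeff_map _ _

/-- The PURE VECTOR of a ring endomorphism `Φ` of `k[ε][σ]`: `pureVec Φ i = (Φ ε_i)(ε = 0) ∈ k[σ]`, the `ε`-free part of the
substitution in slot `i` (ours). [cite: SerreLocalFields1979, Ch. II §4 Lemma 1] -/
noncomputable def pureVec (Φ : (MvPolynomial ι k)[X] →+* (MvPolynomial ι k)[X]) (i : ι) : k[X] :=
  pureMap (Φ (C (MvPolynomial.X i)))

/-- Unfolding (plumbing). [cite: SerreLocalFields1979, Ch. II §4 Lemma 1] -/
theorem pureVec_apply (Φ : (MvPolynomial ι k)[X] →+* (MvPolynomial ι k)[X]) (i : ι) :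
    pureVec Φ i = pureMap (Φ (C (MvPolynomial.X i))) := rfl

/-- The `σ^s`-coefficient of the pure vector is the pure coefficient `coeff 0 ((Φ ε_i).coeff s)`
(= `GradedIsotropy.pureCoeff Φ i s`) (plumbing). [cite: SerreLocalFields1979, Ch. II §4 Lemma 1] -/
theorem coeff_pureVec (Φ : (MvPolynomial ι k)[X] →+* (MvPolynomial ι k)[X]) (i : ι) (s : ℕ) :
    (pureVec Φ i).coeff s = MvPolynomial.coeff 0 ((Φ (C (MvPolynomial.X i))).coeff s) := by
  rw [pureVec_apply, coeff_pureMap, MvPolynomial.constantCoeff_eq]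

/-- The identity substitution has zero pure vector (plumbing). [cite: SerreLocalFields1979, Ch. II §4 Lemma 1] -/
theorem pureVec_id (i : ι) : pureVec (RingHom.id (MvPolynomial ι k)[X]) i = 0 := by
  rw [pureVec_apply, RingHom.id_apply, pureMap_C_X]

/-! ## After `ε = 0`, `Φ` is evaluation at its pure vector -/

/-- On constants: `(Φ (C a))(ε = 0) = a(ε ↦ pureVec Φ)` for `Φ` fixing the scalars (derived here).
[cite: SerreLocalFields1979, Ch. II §4 Lemma 1] -/
theorem pureMap_map_C (Φ : (MvPolynomial ι k)[X] →+* (MvPolynomial ι k)[X])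
    (hC : ∀ c : k, Φ (C (MvPolynomial.C c)) = C (MvPolynomial.C c)) (a : MvPolynomial ι k) :
    pureMap (Φ (C a)) = MvPolynomial.aeval (pureVec Φ) a := by
  have h : pureMap.comp (Φ.comp (Polynomial.C : MvPolynomial ι k →+* (MvPolynomial ι k)[X])) =
      (MvPolynomial.aeval (pureVec Φ) : MvPolynomial ι k →ₐ[k] k[X]).toRingHom := by
    refine MvPolynomial.ringHom_ext (fun c => ?_) (fun j => ?_)
    · simp only [RingHom.coe_comp, Function.comp_apply, AlgHom.toRingHom_eq_coe, RingHom.coe_coe,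
        MvPolynomial.algHom_C, Polynomial.algebraMap_eq]
      rw [hC, pureMap_C_C]
    · simp only [RingHom.coe_comp, Function.comp_apply, AlgHom.toRingHom_eq_coe, RingHom.coe_coe,
        MvPolynomial.aeval_X]
      rfl
  simpa only [RingHom.coe_comp, Function.comp_apply, AlgHom.toRingHom_eq_coe, RingHom.coe_coe] using
    RingHom.congr_fun h a

/-- `(Φ f)(ε = 0) = f(ε ↦ pureVec Φ, σ ↦ σ)` for `Φ` fixing the scalars and `σ` (derived here).
[cite: SerreLocalFields1979, Ch. II §4 Lemma 1] -/
theorem pureMap_map (Φ : (MvPolynomial ι k)[X] →+* (MvPolynomial ι k)[X])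
    (hC : ∀ c : k, Φ (C (MvPolynomial.C c)) = C (MvPolynomial.C c)) (hX : Φ X = X) (f : (MvPolynomial ι k)[X]) :
    pureMap (Φ f) = f.eval₂ (MvPolynomial.aeval (pureVec Φ) : MvPolynomial ι k →ₐ[k] k[X]).toRingHom X := by
  have h : pureMap.comp Φ =
      Polynomial.eval₂RingHom (MvPolynomial.aeval (pureVec Φ) : MvPolynomial ι k →ₐ[k] k[X]).toRingHom X := by
    refine Polynomial.ringHom_ext (fun a => ?_) ?_
    · rw [RingHom.comp_apply, pureMap_map_C Φ hC a, coe_eval₂RingHom, eval₂_C]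
      rfl
    · rw [RingHom.comp_apply, hX, pureMap_X, coe_eval₂RingHom, eval₂_X]
  exact RingHom.congr_fun h f

/-- If every `ε`-variable occurring in `B` is a slot on which `Φ` has NO pure term, then `(Φ B)(ε = 0) = B(ε = 0)`
(derived here; the engine's "an impure monomial supported on pure-free slots stays `ε`-divisible"). [cite: SerreLocalFields1979, Ch. II §4 Lemma 1] -/
theorem pureMap_map_eq_pureMap_of_vars (Φ : (MvPolynomial ι k)[X] →+* (MvPolynomial ι k)[X])
    (hC : ∀ c : k, Φ (C (MvPolynomial.C c)) = C (MvPolynomial.C c)) (hX : Φ X = X) {B : (MvPolynomial ι k)[X]}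
    (hvars : ∀ s, ∀ j ∈ (B.coeff s).vars, pureVec Φ j = 0) : pureMap (Φ B) = pureMap B := by
  have hB : pureMap B = B.eval₂ ((Polynomial.C : k →+* k[X]).comp MvPolynomial.constantCoeff) X := rfl
  rw [pureMap_map Φ hC hX B, hB, eval₂_eq_sum, eval₂_eq_sum, Polynomial.sum_def, Polynomial.sum_def]
  refine Finset.sum_congr rfl fun s _ => ?_
  congr 1
  rw [RingHom.comp_apply]
  change MvPolynomial.aeval (pureVec Φ) (B.coeff s) = _
  rw [MvPolynomial.aeval_eq_constantCoeff_of_vars (hvars s), Polynomial.algebraMap_eq]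

/-! ## LEMMA CP and CP′ -/

/-- **LEMMA CP** (composites; derived here): let `Φ` fix the scalars and `σ`, and suppose every `ε`-variable of the impure part
`Ψ ε_i − ε_i` of slot `i` is a slot on which `Φ` has no pure term.  Then `pureVec (Φ ∘ Ψ) i = pureVec Φ i + pureVec Ψ i`.
[cite: SerreLocalFields1979, Ch. II §4 Lemma 1] -/
theorem pureVec_comp (Φ Ψ : (MvPolynomial ι k)[X] →+* (MvPolynomial ι k)[X])
    (hC : ∀ c : k, Φ (C (MvPolynomial.C c)) = C (MvPolynomial.C c)) (hX : Φ X = X) (i : ι)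
    (hvars : ∀ s, ∀ j ∈ ((Ψ (C (MvPolynomial.X i)) - C (MvPolynomial.X i)).coeff s).vars, pureVec Φ j = 0) :
    pureVec (Φ.comp Ψ) i = pureVec Φ i + pureVec Ψ i := by
  set B := Ψ (C (MvPolynomial.X i)) - C (MvPolynomial.X i) with hB
  have hΨ : Ψ (C (MvPolynomial.X i)) = C (MvPolynomial.X i) + B := (add_sub_cancel _ _).symm
  calc pureVec (Φ.comp Ψ) i = pureMap (Φ (C (MvPolynomial.X i) + B)) := by
        rw [pureVec_apply, RingHom.comp_apply, hΨ]
    _ = pureVec Φ i + pureMap (Φ B) := by rw [map_add, map_add, pureVec_apply]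
    _ = pureVec Φ i + pureMap B := by rw [pureMap_map_eq_pureMap_of_vars Φ hC hX hvars]
    _ = pureVec Φ i + pureVec Ψ i := by rw [hB, map_sub, pureMap_C_X, sub_zero, pureVec_apply Φ, pureVec_apply Ψ]

/-- **LEMMA CP′** (inverses; derived here): under the hypotheses of CP, if `Φ (Ψ ε_i) = ε_i` (e.g. `Ψ` is a right inverse of
`Φ`), then `pureVec Ψ i = − pureVec Φ i` — "the inverse has no pure entry below `w*` and `−P` on the class `w*`".
[cite: SerreLocalFields1979, Ch. II §4 Lemma 1] -/
theorem pureVec_eq_neg_of_comp_apply (Φ Ψ : (MvPolynomial ι k)[X] →+* (MvPolynomial ι k)[X])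
    (hC : ∀ c : k, Φ (C (MvPolynomial.C c)) = C (MvPolynomial.C c)) (hX : Φ X = X) (i : ι)
    (hvars : ∀ s, ∀ j ∈ ((Ψ (C (MvPolynomial.X i)) - C (MvPolynomial.X i)).coeff s).vars, pureVec Φ j = 0)
    (hid : Φ (Ψ (C (MvPolynomial.X i))) = C (MvPolynomial.X i)) :
    pureVec Ψ i = - pureVec Φ i := by
  have h0 : pureVec (Φ.comp Ψ) i = 0 := by
    rw [pureVec_apply, RingHom.comp_apply, hid, pureMap_C_X]
  have h := pureVec_comp Φ Ψ hC hX i hvars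
  rw [h0] at h
  exact eq_neg_of_add_eq_zero_right h.symm

/-! ## The twist `σ ↦ −σ` and the even-class cancellation of FC (A) -/

/-- `pureVec Φ_{−σ} i = τ (pureVec Φ i)` (derived here). [cite: SerreLocalFields1979, Ch. II §4 Lemma 1] -/
theorem pureVec_twistConj (Φ : (MvPolynomial ι k)[X] →+* (MvPolynomial ι k)[X]) (i : ι) :
    pureVec (twistConj Φ) i = sigmaNeg (pureVec Φ i) := by
  rw [pureVec_apply, twistConj_C, pureMap_apply, map_sigmaNeg, pureVec_apply, pureMap_apply]

/-- Coefficientwise: `(pureVec Φ_{−σ} i)_n = (−1)^n (pureVec Φ i)_n` (derived here). [cite: SerreLocalFields1979, Ch. II §4 Lemma 1] -/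
theorem coeff_pureVec_twistConj (Φ : (MvPolynomial ι k)[X] →+* (MvPolynomial ι k)[X]) (i : ι) (n : ℕ) :
    (pureVec (twistConj Φ) i).coeff n = (-1) ^ n * (pureVec Φ i).coeff n := by
  rw [pureVec_twistConj, coeff_sigmaNeg]

/-- `Φ_{−σ}` fixes the scalars when `Φ` does (plumbing). [cite: SerreLocalFields1979, Ch. II §4 Lemma 1] -/
theorem twistConj_C_C (Φ : (MvPolynomial ι k)[X] →+* (MvPolynomial ι k)[X])
    (hC : ∀ c : k, Φ (C (MvPolynomial.C c)) = C (MvPolynomial.C c)) (c : k) :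
    twistConj Φ (C (MvPolynomial.C c)) = C (MvPolynomial.C c) := by
  rw [twistConj_C, hC, sigmaNeg_C]

/-- **FC (A), the pure vector of `Θ₂ = Φ_σ ∘ (Φ_{−σ})⁻¹`** (derived here): let `Φ` fix the scalars and `σ`, let `Ψ` satisfy
`Φ_{−σ} (Ψ ε_i) = ε_i` (a right inverse of `Φ_{−σ}` on slot `i`), and suppose every `ε`-variable of `Ψ ε_i − ε_i` is a slot with no
pure term of `Φ`.  Then `pureVec (Φ ∘ Ψ) i = pureVec Φ i − τ (pureVec Φ i)`. [cite: SerreLocalFields1979, Ch. II §4 Lemma 1] -/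
theorem pureVec_comp_of_twistConj_apply (Φ Ψ : (MvPolynomial ι k)[X] →+* (MvPolynomial ι k)[X])
    (hC : ∀ c : k, Φ (C (MvPolynomial.C c)) = C (MvPolynomial.C c)) (hX : Φ X = X) (i : ι)
    (hinv : twistConj Φ (Ψ (C (MvPolynomial.X i))) = C (MvPolynomial.X i))
    (hvars : ∀ s, ∀ j ∈ ((Ψ (C (MvPolynomial.X i)) - C (MvPolynomial.X i)).coeff s).vars, pureVec Φ j = 0) :
    pureVec (Φ.comp Ψ) i = pureVec Φ i - sigmaNeg (pureVec Φ i) := by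
  have hvars' : ∀ s, ∀ j ∈ ((Ψ (C (MvPolynomial.X i)) - C (MvPolynomial.X i)).coeff s).vars,
      pureVec (twistConj Φ) j = 0 := fun s j hj => by
    rw [pureVec_twistConj, hvars s j hj, map_zero]
  rw [pureVec_comp Φ Ψ hC hX i hvars,
    pureVec_eq_neg_of_comp_apply (twistConj Φ) Ψ (twistConj_C_C Φ hC) (twistConj_X Φ hX) i hvars' hinv,
    pureVec_twistConj, sub_eq_add_neg]

/-- Coefficientwise: `(pureVec Θ₂ i)_n = (1 − (−1)^n) · (pureVec Φ i)_n` (derived here).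
[cite: SerreLocalFields1979, Ch. II §4 Lemma 1] -/
theorem coeff_pureVec_comp_of_twistConj_apply (Φ Ψ : (MvPolynomial ι k)[X] →+* (MvPolynomial ι k)[X])
    (hC : ∀ c : k, Φ (C (MvPolynomial.C c)) = C (MvPolynomial.C c)) (hX : Φ X = X) (i : ι)
    (hinv : twistConj Φ (Ψ (C (MvPolynomial.X i))) = C (MvPolynomial.X i))
    (hvars : ∀ s, ∀ j ∈ ((Ψ (C (MvPolynomial.X i)) - C (MvPolynomial.X i)).coeff s).vars, pureVec Φ j = 0) (n : ℕ) :
    (pureVec (Φ.comp Ψ) i).coeff n = (1 - (-1) ^ n) * (pureVec Φ i).coeff n := by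
  rw [pureVec_comp_of_twistConj_apply Φ Ψ hC hX i hinv hvars, coeff_sub, coeff_sigmaNeg]
  ring

/-- **FC (A), even-class cancellation** (derived here): in the situation above the `σ^n`-coefficient of `pureVec Θ₂ i` VANISHES
for every even `n` — the class-`w*` pure parts `c σ^{j*}` of `Φ_σ` and `(Φ_{−σ})⁻¹` cancel when `j*` is even.
[cite: SerreLocalFields1979, Ch. II §4 Lemma 1] -/
theorem coeff_pureVec_comp_of_twistConj_apply_eq_zero (Φ Ψ : (MvPolynomial ι k)[X] →+* (MvPolynomial ι k)[X])
    (hC : ∀ c : k, Φ (C (MvPolynomial.C c)) = C (MvPolynomial.C c)) (hX : Φ X = X) (i : ι)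
    (hinv : twistConj Φ (Ψ (C (MvPolynomial.X i))) = C (MvPolynomial.X i))
    (hvars : ∀ s, ∀ j ∈ ((Ψ (C (MvPolynomial.X i)) - C (MvPolynomial.X i)).coeff s).vars, pureVec Φ j = 0)
    {n : ℕ} (hn : Even n) : (pureVec (Φ.comp Ψ) i).coeff n = 0 := by
  rw [coeff_pureVec_comp_of_twistConj_apply Φ Ψ hC hX i hinv hvars n, hn.neg_one_pow, sub_self, zero_mul]

/-- … and on a slot where `Φ` itself has no pure term, `Θ₂` has none either (derived here; the slots lighter than `w*`).
[cite: SerreLocalFields1979, Ch. II §4 Lemma 1] -/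
theorem pureVec_comp_of_twistConj_apply_eq_zero (Φ Ψ : (MvPolynomial ι k)[X] →+* (MvPolynomial ι k)[X])
    (hC : ∀ c : k, Φ (C (MvPolynomial.C c)) = C (MvPolynomial.C c)) (hX : Φ X = X) (i : ι)
    (hinv : twistConj Φ (Ψ (C (MvPolynomial.X i))) = C (MvPolynomial.X i))
    (hvars : ∀ s, ∀ j ∈ ((Ψ (C (MvPolynomial.X i)) - C (MvPolynomial.X i)).coeff s).vars, pureVec Φ j = 0)
    (hi : pureVec Φ i = 0) : pureVec (Φ.comp Ψ) i = 0 := by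
  rw [pureVec_comp_of_twistConj_apply Φ Ψ hC hX i hinv hvars, hi, map_zero, sub_zero]

/-! ## Bookkeeping for the end of FC (A) -/

/-- If `Φ ∘ Ψ = id` and `Ψ` is a two-sided inverse of `Φ_{−σ}`, then `Φ = Φ_{−σ}` (plumbing: `Φ = Φ ∘ (Ψ ∘ Φ_{−σ}) = Φ_{−σ}`).
[cite: SerreLocalFields1979, Ch. II §4 Lemma 1] -/
theorem eq_twistConj_of_comp {A₀ : Type*} [CommRing A₀] (Φ Ψ : A₀[X] →+* A₀[X]) (hΘ : Φ.comp Ψ = RingHom.id _)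
    (hinv : Ψ.comp (twistConj Φ) = RingHom.id _) : Φ = twistConj Φ := by
  calc Φ = Φ.comp (Ψ.comp (twistConj Φ)) := by rw [hinv, RingHom.comp_id]
    _ = (Φ.comp Ψ).comp (twistConj Φ) := by rw [RingHom.comp_assoc]
    _ = twistConj Φ := by rw [hΘ, RingHom.id_comp]

/-- If `Φ_{−σ} = Φ` and `2` is regular in `A₀`, every `Φ (C a)` is EVEN in `σ` — so `Φ (C a) = g(σ²)` with `g = contract 2 (Φ (C a))`
by `IsSigmaEven.expand_contract` (T49 (i); derived here). [cite: SerreLocalFields1979, Ch. II §4 Lemma 1] -/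
theorem isSigmaEven_map_C_of_twistConj_eq {A₀ : Type*} [CommRing A₀] {Φ : A₀[X] →+* A₀[X]} (h : twistConj Φ = Φ)
    (h2 : ∀ c : A₀, 2 * c = 0 → c = 0) (a : A₀) : IsSigmaEven (Φ (C a)) := by
  have hC : IsSigmaEven (C a : A₀[X]) := by
    simpa only [expand_C] using isSigmaEven_expand_two (C a : A₀[X])
  exact hC.apply h h2

/-- Hence `Φ (C a) = (contract 2 (Φ (C a)))(σ²)` for every constant `a` (T49 (i), the `v := σ²` re-parametrisation of FC (A); derived
here). [cite: SerreLocalFields1979, Ch. II §4 Lemma 1] -/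
theorem expand_contract_map_C_of_twistConj_eq {A₀ : Type*} [CommRing A₀] {Φ : A₀[X] →+* A₀[X]} (h : twistConj Φ = Φ)
    (h2 : ∀ c : A₀, 2 * c = 0 → c = 0) (a : A₀) : expand A₀ 2 (contract 2 (Φ (C a))) = Φ (C a) :=
  (isSigmaEven_map_C_of_twistConj_eq h h2 a).expand_contract

end PureVector

end Literature.AlgebraicGeometry.Resolution.WeightedBlowup
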